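import Summits.Ventures.HodgeRepro2.T5CyclotomicHeckeCommutative
import Mathlib.NumberTheory.LSeries.PrimesInAP

/-!
# FOR EVERY ODD PRIME `ℓ`: infinitely many places of `ℚ(ζ_ℓ)⁺` stay prime in `ℚ(ζ_ℓ)` (with the record's Hecke
# algebra `k[T₁]`) and infinitely many split (with it commutative), by Dirichlet

Tier-5 support N3 / §G-N4.2 (seat p3, gen 79). File 272 gives the criterion «`v ∣ p` stays prime iff
`orderOf (p mod ℓ)` is even». The classes `−1` (order `2`) and `1` (order `1`) modulo `ℓ` contain infinitely many
primes (Mathlib's `Nat.infinite_setOf_prime_and_eq_mod`), and a chosen place above each such prime is injective in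
`p` (it lies above `(p)`), so both families of places are infinite for every odd `ℓ`:

* `orderOf_neg_one_zmod`, **`infinite_setOf_prime_and_even_orderOf`**, **`infinite_setOf_prime_and_odd_orderOf`** —
  infinitely many primes `p ≠ ℓ` of even (resp. odd) order modulo `ℓ`;
* `primeAboveCyc`, `placeAboveCyc`, `placeAboveCyc_injective_of_prime`, `vEvenOf`, `vOddOf`, `liesOver_vEvenOf`,
  `liesOver_vOddOf`, `vEvenOf_injective`, `vOddOf_injective` — a chosen place of `ℚ(ζ_ℓ)⁺` above each such prime;
* **`infinite_setOf_staysPrime`**, **`infinite_setOf_nonempty_algEquiv_polynomial`** — infinitely many places of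
  `ℚ(ζ_ℓ)⁺` stay prime in `ℚ(ζ_ℓ)`, with `H(U(1 ⊗ H₀), K_v) ≃ k[X]`;
* **`infinite_setOf_ncard_primesOver_eq_two`**, **`infinite_setOf_heckeAlgebra_mul_comm`** — infinitely many have
  two places of `ℚ(ζ_ℓ)` above them, with the record's algebra commutative.

§8(d): uses an L-value-free non-vanishing device: NO.
-/

open Matrix NumberField NumberField.IsCMField IsDedekindDomain IsDedekindDomain.HeightOneSpectrum Module Polynomial
  MulAction
open scoped TensorProduct Pointwise
open Summit.Ventures.HodgeRepro2.T5UnitaryGroupForm Summit.Ventures.HodgeRepro2.T5UnitaryHeckeAdjoint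
  Summit.Ventures.HodgeRepro2.T5HeckePermutationModule Summit.Ventures.HodgeRepro2.T5RecordHyperspecial
  Summit.Ventures.HodgeRepro2.T5RecordSatakeToy Summit.Ventures.HodgeRepro2.T5SplitPlaceUnitaryGroup
  Summit.Ventures.HodgeRepro2.T5NonSplitPlaceUnitaryGroup Summit.Ventures.HodgeRepro2.T5FinitePlaceCM
  Summit.Ventures.HodgeRepro2.T5StarOfInvolution Summit.Ventures.HodgeRepro2.T5GlobalLatticeAlmostAll
  Summit.Ventures.HodgeRepro2.T5FinitePlaceSplitClassification Summit.Ventures.HodgeRepro2.T5CyclotomicStaysPrimeIffEven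
  Summit.Ventures.HodgeRepro2.T5CyclotomicHeckeCommutative

namespace Summit.Ventures.HodgeRepro2.T5CyclotomicInfinitelyManyPlaces

section Dirichlet

variable (ℓ : ℕ)

/-- `−1` has order `2` modulo `ℓ > 2`. -/
theorem orderOf_neg_one_zmod (h2 : 2 < ℓ) : orderOf (-1 : ZMod ℓ) = 2 := by
  haveI : Fact (2 < ℓ) := ⟨h2⟩
  haveI : Fact (Nat.Prime 2) := ⟨Nat.prime_two⟩
  exact orderOf_eq_prime neg_one_sq ZMod.neg_one_ne_one

/-- **Infinitely many primes `p ≠ ℓ` of even order modulo `ℓ`** (Dirichlet for the class `−1 ≡ ℓ − 1`). -/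
theorem infinite_setOf_prime_and_even_orderOf [hℓ : Fact ℓ.Prime] (h2 : 2 < ℓ) :
    {p : ℕ | p.Prime ∧ p.Coprime ℓ ∧ Even (orderOf (p : ZMod ℓ))}.Infinite := by
  have hu : IsUnit ((ℓ - 1 : ℕ) : ZMod ℓ) := by
    rw [natCast_sub_one_eq_neg_one]
    exact isUnit_neg_one
  refine (Nat.infinite_setOf_prime_and_eq_mod hu).mono ?_
  intro p hp
  refine ⟨hp.1, (ZMod.isUnit_iff_coprime p ℓ).mp (by rw [hp.2]; exact hu), ?_⟩
  rw [hp.2, natCast_sub_one_eq_neg_one, orderOf_neg_one_zmod ℓ h2]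
  exact even_two

/-- **Infinitely many primes `p ≠ ℓ` of odd order modulo `ℓ`** (Dirichlet for the class `1`). -/
theorem infinite_setOf_prime_and_odd_orderOf [NeZero ℓ] :
    {p : ℕ | p.Prime ∧ p.Coprime ℓ ∧ Odd (orderOf (p : ZMod ℓ))}.Infinite := by
  have hu : IsUnit ((1 : ℕ) : ZMod ℓ) := by
    rw [Nat.cast_one]
    exact isUnit_one
  refine (Nat.infinite_setOf_prime_and_eq_mod hu).mono ?_
  intro p hp
  refine ⟨hp.1, (ZMod.isUnit_iff_coprime p ℓ).mp (by rw [hp.2]; exact hu), ?_⟩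
  rw [hp.2, Nat.cast_one, orderOf_one]
  exact odd_one

end Dirichlet

section Chosen

variable (K : Type*) [Field K] [NumberField K]

/-- A chosen prime of `𝓞_{K⁺}` above a rational prime `p` (any number field `K`). -/
noncomputable def primeAboveCyc (p : ℕ) [hp : Fact p.Prime] :
    (Ideal.span {(p : ℤ)}).primesOver (𝓞 (maximalRealSubfield K)) :=
  haveI : (Ideal.span {(p : ℤ)}).IsPrime :=
    (Ideal.span_singleton_prime (Nat.cast_ne_zero.mpr hp.out.ne_zero)).mpr (Nat.prime_iff_prime_int.mp hp.out)
  (Ideal.nonempty_primesOver (S := 𝓞 (maximalRealSubfield K)) (Ideal.span {(p : ℤ)})).some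

/-- The chosen prime is prime. -/
theorem primeAboveCyc_isPrime (p : ℕ) [hp : Fact p.Prime] : (primeAboveCyc K p).1.IsPrime :=
  (primeAboveCyc K p).2.1

/-- The chosen prime lies above `p`. -/
theorem primeAboveCyc_liesOver (p : ℕ) [hp : Fact p.Prime] :
    (primeAboveCyc K p).1.LiesOver (Ideal.span {(p : ℤ)}) :=
  (primeAboveCyc K p).2.2

/-- The chosen prime is not `⊥`. -/
theorem primeAboveCyc_ne_bot (p : ℕ) [hp : Fact p.Prime] : (primeAboveCyc K p).1 ≠ ⊥ :=
  haveI := primeAboveCyc_liesOver K p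
  Ideal.ne_bot_of_liesOver_of_ne_bot
    ((Ideal.span_singleton_eq_bot).not.mpr (Nat.cast_ne_zero.mpr hp.out.ne_zero) : Ideal.span {(p : ℤ)} ≠ ⊥)
    (primeAboveCyc K p).1

/-- A chosen place of `K⁺` above `p`. -/
noncomputable def placeAboveCyc (p : ℕ) [hp : Fact p.Prime] : HeightOneSpectrum (𝓞 (maximalRealSubfield K)) where
  asIdeal := (primeAboveCyc K p).1
  isPrime := primeAboveCyc_isPrime K p
  ne_bot := primeAboveCyc_ne_bot K p

/-- The chosen place lies above `p`. -/
theorem liesOver_placeAboveCyc (p : ℕ) [hp : Fact p.Prime] :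
    (placeAboveCyc K p).asIdeal.LiesOver (Ideal.span {(p : ℤ)}) :=
  primeAboveCyc_liesOver K p

/-- **The chosen places are pairwise distinct**: a place above `(p)` and `(q)` forces `p = q`. -/
theorem placeAboveCyc_injective_of_prime {p q : ℕ} (hp : p.Prime) (hq : q.Prime)
    (h : placeAboveCyc K p (hp := ⟨hp⟩) = placeAboveCyc K q (hp := ⟨hq⟩)) : p = q := by
  have hp' := liesOver_placeAboveCyc K p (hp := ⟨hp⟩)
  have hq' := liesOver_placeAboveCyc K q (hp := ⟨hq⟩)
  rw [h] at hp'
  have hpq : Ideal.span {(p : ℤ)} = Ideal.span {(q : ℤ)} := hp'.over.trans hq'.over.symm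
  have hdvd : (q : ℤ) ∣ (p : ℤ) := by
    rw [← Ideal.mem_span_singleton, ← hpq]
    exact Ideal.mem_span_singleton_self _
  rw [Int.natCast_dvd_natCast] at hdvd
  exact ((Nat.prime_dvd_prime_iff_eq hq hp).mp hdvd).symm

variable (ℓ : ℕ)

/-- A chosen place above each prime `p ≠ ℓ` of even order modulo `ℓ`. -/
noncomputable def vEvenOf (p : {p : ℕ // p.Prime ∧ p.Coprime ℓ ∧ Even (orderOf (p : ZMod ℓ))}) :
    HeightOneSpectrum (𝓞 (maximalRealSubfield K)) :=
  haveI : Fact p.1.Prime := ⟨p.2.1⟩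
  placeAboveCyc K p.1

/-- A chosen place above each prime `p ≠ ℓ` of odd order modulo `ℓ`. -/
noncomputable def vOddOf (p : {p : ℕ // p.Prime ∧ p.Coprime ℓ ∧ Odd (orderOf (p : ZMod ℓ))}) :
    HeightOneSpectrum (𝓞 (maximalRealSubfield K)) :=
  haveI : Fact p.1.Prime := ⟨p.2.1⟩
  placeAboveCyc K p.1

/-- `vEvenOf p` lies above `p`. -/
theorem liesOver_vEvenOf (p : {p : ℕ // p.Prime ∧ p.Coprime ℓ ∧ Even (orderOf (p : ZMod ℓ))}) :
    (vEvenOf K ℓ p).asIdeal.LiesOver (Ideal.span {(p.1 : ℤ)}) :=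
  liesOver_placeAboveCyc K p.1 (hp := ⟨p.2.1⟩)

/-- `vOddOf p` lies above `p`. -/
theorem liesOver_vOddOf (p : {p : ℕ // p.Prime ∧ p.Coprime ℓ ∧ Odd (orderOf (p : ZMod ℓ))}) :
    (vOddOf K ℓ p).asIdeal.LiesOver (Ideal.span {(p.1 : ℤ)}) :=
  liesOver_placeAboveCyc K p.1 (hp := ⟨p.2.1⟩)

/-- `vEvenOf` is injective. -/
theorem vEvenOf_injective : Function.Injective (vEvenOf K ℓ) := fun p q h =>
  Subtype.ext (placeAboveCyc_injective_of_prime K p.2.1 q.2.1 h)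

/-- `vOddOf` is injective. -/
theorem vOddOf_injective : Function.Injective (vOddOf K ℓ) := fun p q h =>
  Subtype.ext (placeAboveCyc_injective_of_prime K p.2.1 q.2.1 h)

end Chosen

section Places

variable (ℓ : ℕ) [hℓ : Fact ℓ.Prime] (h2 : 2 < ℓ)
variable (K : Type*) [Field K] [CharZero K] [IsCyclotomicExtension {ℓ} ℚ K]
include h2

/-- **Infinitely many places of `ℚ(ζ_ℓ)⁺` stay prime in `ℚ(ζ_ℓ)`**, for every odd prime `ℓ`. -/
theorem infinite_setOf_staysPrime :
    haveI := numberFieldCyc ℓ K; haveI := isCMFieldCyc ℓ h2 K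
    {v : HeightOneSpectrum (𝓞 (maximalRealSubfield K)) | ∃ w : HeightOneSpectrum (𝓞 K),
      Ideal.map (algebraMap (𝓞 (maximalRealSubfield K)) (𝓞 K)) v.asIdeal = w.asIdeal}.Infinite := by
  haveI := numberFieldCyc ℓ K
  haveI := isCMFieldCyc ℓ h2 K
  haveI : Infinite {p : ℕ // p.Prime ∧ p.Coprime ℓ ∧ Even (orderOf (p : ZMod ℓ))} :=
    (infinite_setOf_prime_and_even_orderOf ℓ h2).to_subtype
  exact Set.infinite_of_injective_forall_mem (vEvenOf_injective K ℓ) fun p =>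
    haveI : Fact p.1.Prime := ⟨p.2.1⟩
    (exists_map_eq_iff_even ℓ h2 K p.1 p.2.2.1 (vEvenOf K ℓ p) (hv := liesOver_vEvenOf K ℓ p)).mpr p.2.2.2

/-- **At infinitely many places `v` of `ℚ(ζ_ℓ)⁺` the record's spherical Hecke algebra `H(U(1 ⊗ H₀), K_v)` is
`k[X]`**, for every family `l` of generators and every odd prime `ℓ`. -/
theorem infinite_setOf_nonempty_algEquiv_polynomial (k : Type*) [Field k] :
    haveI := numberFieldCyc ℓ K; haveI := isCMFieldCyc ℓ h2 K
    {v : HeightOneSpectrum (𝓞 (maximalRealSubfield K)) | ∀ {r : ℕ} (l : Fin r → 𝓞 K),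
      Submodule.span (𝓞 (maximalRealSubfield K)) (Set.range l) = ⊤ →
      Nonempty (Polynomial k ≃ₐ[k]
        (letI := tensorStarRing K v; ↥(heckeAlgebra k (recordHyperspecial K v l (gramToy K)))))}.Infinite := by
  haveI := numberFieldCyc ℓ K
  haveI := isCMFieldCyc ℓ h2 K
  haveI : Infinite {p : ℕ // p.Prime ∧ p.Coprime ℓ ∧ Even (orderOf (p : ZMod ℓ))} :=
    (infinite_setOf_prime_and_even_orderOf ℓ h2).to_subtype
  exact Set.infinite_of_injective_forall_mem (vEvenOf_injective K ℓ) fun p {r} l hl =>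
    haveI : Fact p.1.Prime := ⟨p.2.1⟩
    nonempty_algEquiv_polynomial_record_cyclotomic_of_even ℓ h2 K p.1 p.2.2.1 (vEvenOf K ℓ p)
      (hv := liesOver_vEvenOf K ℓ p) p.2.2.2 k l hl

/-- **Infinitely many places of `ℚ(ζ_ℓ)⁺` have two places of `ℚ(ζ_ℓ)` above them.** -/
theorem infinite_setOf_ncard_primesOver_eq_two :
    haveI := numberFieldCyc ℓ K; haveI := isCMFieldCyc ℓ h2 K
    {v : HeightOneSpectrum (𝓞 (maximalRealSubfield K)) | (v.asIdeal.primesOver (𝓞 K)).ncard = 2}.Infinite := by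
  haveI := numberFieldCyc ℓ K
  haveI := isCMFieldCyc ℓ h2 K
  haveI : Infinite {p : ℕ // p.Prime ∧ p.Coprime ℓ ∧ Odd (orderOf (p : ZMod ℓ))} :=
    (infinite_setOf_prime_and_odd_orderOf ℓ).to_subtype
  exact Set.infinite_of_injective_forall_mem (vOddOf_injective K ℓ) fun p =>
    haveI : Fact p.1.Prime := ⟨p.2.1⟩
    (ncard_primesOver_eq_two_iff_odd ℓ h2 K p.1 p.2.2.1 (vOddOf K ℓ p) (hv := liesOver_vOddOf K ℓ p)).mpr p.2.2.2

/-- **At infinitely many places `v` of `ℚ(ζ_ℓ)⁺` with two places above them the record's spherical Hecke algebra is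
commutative**, for every family `l` of generators and every odd prime `ℓ`. -/
theorem infinite_setOf_heckeAlgebra_mul_comm (k : Type*) [Field k] :
    haveI := numberFieldCyc ℓ K; haveI := isCMFieldCyc ℓ h2 K
    {v : HeightOneSpectrum (𝓞 (maximalRealSubfield K)) | (v.asIdeal.primesOver (𝓞 K)).ncard = 2 ∧
      ∀ {r : ℕ} (l : Fin r → 𝓞 K), Submodule.span (𝓞 (maximalRealSubfield K)) (Set.range l) = ⊤ →
      ∀ T S : (letI := tensorStarRing K v; ↥(heckeAlgebra k (recordHyperspecial K v l (gramToy K)))),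
        T * S = S * T}.Infinite := by
  haveI := numberFieldCyc ℓ K
  haveI := isCMFieldCyc ℓ h2 K
  haveI : Infinite {p : ℕ // p.Prime ∧ p.Coprime ℓ ∧ Odd (orderOf (p : ZMod ℓ))} :=
    (infinite_setOf_prime_and_odd_orderOf ℓ).to_subtype
  exact Set.infinite_of_injective_forall_mem (vOddOf_injective K ℓ) fun p =>
    haveI : Fact p.1.Prime := ⟨p.2.1⟩
    ⟨(ncard_primesOver_eq_two_iff_odd ℓ h2 K p.1 p.2.2.1 (vOddOf K ℓ p) (hv := liesOver_vOddOf K ℓ p)).mpr p.2.2.2,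
      fun {r} l hl T S => heckeAlgebra_mul_comm_record_cyclotomic ℓ h2 K p.1 p.2.2.1 (vOddOf K ℓ p)
        (hv := liesOver_vOddOf K ℓ p) k l hl T S⟩

end Places

end Summit.Ventures.HodgeRepro2.T5CyclotomicInfinitelyManyPlaces
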